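import Literature.AlgebraicGeometry.Resolution.StrictNormalCrossingsAt
import Literature.AlgebraicGeometry.Resolution.PointBlowupIntersectionMultiplicityFinite
import HarnessLib

/-!
# Crux `PatchingRelPerfect` (stmt-ResolutionOfSingularities-16161), chain W5.2 — F7(β) (β-AX) X3 C-I (M2b-S′), STEP C (local algebra):
# one regular branch, or two transversal regular branches, in a regular local ring of dimension two are strict normal crossings

[OURS · L1 W5.2 · F7(β) (β-AX) X3 C-I (M2b-S′) LOCAL CURVE-CONFIGURATION ENGINE · res-D-pv-034 AS res-L1-s36-pv-3 per NAMING G12-28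
(module M4, part «STEP C», blow-up free).]  Replaces the role of NO printed item; NOT a statement of the manuscript under review;
fact-free, def-free.  AI-written; AI review is weaker than expert review.

The end state of the point-blow-up algorithm (Stacks 0BIC, proof ¶2: «exactly two of the curves pass through `p`, they are regular
at `p` and `m_p(Y_i ∩ Y_j) = 1`») in ring form, with the tree's pointwise snc predicate `IsSNCIdeal` (StrictNormalCrossingsAt.lean):
* `isSNCIdeal_span_singleton` — ONE branch: `B/(f)` regular, `f ≠ 0` ⇒ `(f)` is an snc ideal;
* `not_mem_span_singleton_of_sup_eq_maximalIdeal` — transversal ⇒ neither local equation divides the other (dimension `≥ 2`);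
* `isSNCIdeal_span_mul_of_sup_eq_maximalIdeal` — TWO transversal branches `(f) + (g) = 𝔪` in dimension `≥ 2` ⇒ `(f g)` is an snc ideal;
* `sup_span_eq_maximalIdeal_iff_length_eq_one` — transversality `(f) + (g) = 𝔪` ⟺ the intersection multiplicity
  `ℓ(B ⧸ ((f) + (g))) = 1` (the currency of Stacks 0BI7 / `Stacks0BI7_intersectionMultiplicityDrop_proof`).

## References
* The Stacks Project, Tag 0BIC (Lemma 54.15.6, proof ¶2), Tag 0BI9, Tag 0BIA. [StacksProject]
* H. Matsumura, *Commutative Ring Theory* (1986), Thm. 14.2. [Matsumura1987]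
-/

-- `Summit.<Summit>.<Sub>.Theorems` with `Sub = Summit` (single-conjunct summit, D-0017)
set_option linter.dupNamespace false

noncomputable section

open IsLocalRing
open Literature.AlgebraicGeometry.Resolution

namespace Summit.ResolutionOfSingularities.ResolutionOfSingularities.Theorems.CurveConfig

universe u

variable {B : Type u} [CommRing B]

/-- **One regular branch is an snc ideal**: `f ∈ 𝔪`, `f ≠ 0`, `B/(f)` regular ⇒ `IsSNCIdeal (f)`.
[cite: StacksProject, Tag 0BI9] -/
theorem isSNCIdeal_span_singleton [IsRegularLocalRing B] {f : B} (hf : f ∈ maximalIdeal B) (hf0 : f ≠ 0)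
    [h : IsRegularLocalRing (B ⧸ Ideal.span {f})] : IsSNCIdeal (Ideal.span {f}) := by
  have hrange : Set.range ![f] = {f} := by simp
  haveI : IsRegularLocalRing (B ⧸ Ideal.span (Set.range ![f])) := by rw [hrange]; exact h
  refine IsSNCIdeal.of_isRegularLocalRing_quotient (t := 1) le_rfl ![f] (fun i => by fin_cases i; exact hf) (fun i => ?_) ?_
  · have hempty : {j : Fin 1 | j ≠ i} = (∅ : Set (Fin 1)) := by
      ext j; simp [Subsingleton.elim j i]
    rw [hempty, Set.image_empty, Ideal.span_empty, Ideal.mem_bot]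
    fin_cases i
    exact hf0
  · simp

/-- **Transversal branches do not divide one another** (dimension `≥ 2`): if `(f) + (g) = 𝔪` in a local ring of Krull dimension
`≥ 2` then `f ∉ (g)` — else `𝔪 = (g)` would be principal. [folklore] -/
theorem not_mem_span_singleton_of_sup_eq_maximalIdeal [IsLocalRing B] [IsNoetherianRing B] {f g : B}
    (hfg : Ideal.span {f} ⊔ Ideal.span {g} = maximalIdeal B) (hdim : 2 ≤ ringKrullDim B) : f ∉ Ideal.span {g} := by
  intro hf
  have hmax : maximalIdeal B = Ideal.span {g} := by
    rw [← hfg]; exact le_antisymm (sup_le (by rwa [Ideal.span_singleton_le_iff_mem]) le_rfl) le_sup_right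
  -- a principal maximal ideal has height ≤ 1 (Krull)
  haveI : (Ideal.span {g}).IsPrincipal := ⟨g, rfl⟩
  haveI : (Ideal.span {g}).IsMaximal := hmax ▸ maximalIdeal.isMaximal B
  have hmin : Ideal.span {g} ∈ (Ideal.span {g}).minimalPrimes := by
    rw [Ideal.minimalPrimes_eq_subsingleton_self]; exact Set.mem_singleton _
  have h1 : (maximalIdeal B).height ≤ 1 := by
    rw [hmax]; exact Ideal.height_le_one_of_isPrincipal_of_mem_minimalPrimes _ _ hmin
  have h2 : ringKrullDim B ≤ 1 := by
    rw [← IsLocalRing.maximalIdeal_height_eq_ringKrullDim]; exact_mod_cast h1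
  have : (2 : WithBot ℕ∞) ≤ 1 := hdim.trans h2
  exact absurd this (by decide)

/-- **Two transversal regular branches form an snc ideal**: `f, g ∈ 𝔪` with `(f) + (g) = 𝔪` in a regular local ring of dimension
`≥ 2` ⇒ `IsSNCIdeal (f g)` (`f, g` is then a regular system of parameters and dimension `= 2`). [cite: StacksProject, Tag 0BIC (proof ¶2)] -/
theorem isSNCIdeal_span_mul_of_sup_eq_maximalIdeal [IsRegularLocalRing B] {f g : B} (hf : f ∈ maximalIdeal B)
    (hg : g ∈ maximalIdeal B) (hfg : Ideal.span {f} ⊔ Ideal.span {g} = maximalIdeal B) (hdim : 2 ≤ ringKrullDim B) :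
    IsSNCIdeal (Ideal.span {f * g}) := by
  have hrange : Ideal.span (Set.range ![f, g]) = maximalIdeal B := by
    rw [← hfg, show Set.range ![f, g] = {f, g} by simp [Set.pair_comm], Ideal.span_insert]
  haveI : IsRegularLocalRing (B ⧸ Ideal.span (Set.range ![f, g])) := by
    rw [hrange]
    letI : Field (B ⧸ maximalIdeal B) := Ideal.Quotient.field _
    infer_instance
  refine IsSNCIdeal.of_isRegularLocalRing_quotient (t := 2) (by norm_num) ![f, g]
    (fun i => by fin_cases i <;> simp [hf, hg]) (fun i => ?_) (by simp [Fin.prod_univ_two])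
  fin_cases i
  · have h : (![f, g] : Fin 2 → B) '' {j : Fin 2 | j ≠ 0} = {g} := by
      ext b
      simp only [Set.mem_image, Set.mem_setOf_eq, Set.mem_singleton_iff]
      constructor
      · rintro ⟨j, hj, rfl⟩; fin_cases j <;> simp_all
      · rintro rfl; exact ⟨1, by simp, by simp⟩
    simp only [Fin.zero_eta, Fin.isValue, Matrix.cons_val_zero]
    rw [h]
    exact not_mem_span_singleton_of_sup_eq_maximalIdeal hfg hdim
  · have h : (![f, g] : Fin 2 → B) '' {j : Fin 2 | j ≠ 1} = {f} := by
      ext b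
      simp only [Set.mem_image, Set.mem_setOf_eq, Set.mem_singleton_iff]
      constructor
      · rintro ⟨j, hj, rfl⟩; fin_cases j <;> simp_all
      · rintro rfl; exact ⟨0, by simp, by simp⟩
    simp only [Fin.mk_one, Fin.isValue, Matrix.cons_val_one, Matrix.cons_val_fin_one]
    rw [h]
    exact not_mem_span_singleton_of_sup_eq_maximalIdeal (sup_comm (Ideal.span {f}) _ ▸ hfg) hdim

/-- **Transversality is intersection multiplicity one**: for `f, g ∈ 𝔪`, `(f) + (g) = 𝔪` iff `ℓ_B(B ⧸ ((f) + (g))) = 1`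
(the invariant of Stacks (54.15.2.1)). [cite: StacksProject, Tag 0BI6] -/
theorem sup_span_eq_maximalIdeal_iff_length_eq_one [IsLocalRing B] {f g : B} (hf : f ∈ maximalIdeal B) (hg : g ∈ maximalIdeal B) :
    Ideal.span {f} ⊔ Ideal.span {g} = maximalIdeal B ↔
      Module.length B (B ⧸ (Ideal.span {f} ⊔ Ideal.span {g})) = 1 := by
  constructor
  · intro h; rw [h]; exact length_quotient_maximalIdeal
  · intro h
    have hle : Ideal.span {f} ⊔ Ideal.span {g} ≤ maximalIdeal B :=
      sup_le (by rwa [Ideal.span_singleton_le_iff_mem]) (by rwa [Ideal.span_singleton_le_iff_mem])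
    have hsimple : IsSimpleModule B (B ⧸ (Ideal.span {f} ⊔ Ideal.span {g})) := Module.length_eq_one_iff.mp h
    have hmax : (Ideal.span {f} ⊔ Ideal.span {g}).IsMaximal :=
      Ideal.isMaximal_def.mpr (isSimpleModule_iff_isCoatom.mp hsimple)
    exact (hmax.eq_of_le (maximalIdeal.isMaximal B).ne_top hle)

end Summit.ResolutionOfSingularities.ResolutionOfSingularities.Theorems.CurveConfig

end
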